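import Mathlib
import HarnessLib
import Literature.Analysis.ValidatedNumerics.UnivariateSecondOrderIntervalNewton
import Literature.Analysis.ValidatedNumerics.ROrderConvergence

/-!
# Alefeld–Herzberger Ch. 7 §D, Theorem 5 for general `p ≥ 1`: the always convergent higher-order
# interval Newton method (15) — soundness (16), monotone linear convergence (17), the order bound (18)
# with the book's constants `γᵢ`, and R-order `≥ p + 1`

Topic `Literature/Analysis/ValidatedNumerics` (everything proved; no named facts).  Source:
G. Alefeld, J. Herzberger, *Introduction to Interval Computations* (Academic Press 1983), Ch. 7 §D
"Higher order methods", pp. 80–84, iteration (15) and **Theorem 5** [cite: AlefeldHerzberger1983, Ch. 7 §D Thm 5];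
the R-order conclusion via Appendix A, Thm 2 [cite: AlefeldHerzberger1983, Appendix A Thm 2].

The tree's `UnivariateSecondOrderIntervalNewton.lean` types (15)/Theorem 5 for `p = 1` ONLY (its
docstring: *"(15) for general p ≥ 2 … are not typed here"*), with `f, f′, f″` as separate functions and
without the R-order statement.  This file types the GENERAL case `p ≥ 1` with `f ∈ C^{p+1}`
(`ContDiff ℝ (p + 1) f`, derivatives `deriv f`, `iteratedDeriv v f`):

* `taylorStep f i x E Y` — the Taylor step of (15) as an exact range (independent occurrences, exact
  power ranges); `root_mem_taylorStep` — **(16)** for one step, from the two-sided Taylor formula with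
  Lagrange remainder in global iterated derivatives (`taylor_eq_sum_add`, a repackaging of Mathlib's
  `taylor_mean_remainder_lagrange_iteratedDeriv`); `abs_sub_le_of_mem_taylorStep` — the width of one
  Taylor step by *"the rules for width from Chapter 2"* (`|aᵛ − bᵛ| ≤ v·max(|a|,|b|)^{v−1}|a − b|`,
  `d(A) ≤ 2|A|`).
* `gammaSeq μ d₀ F` — the book's constants: `γ₀ = 1`, `γ₁ = |F₂/M|`,
  `γ_{i+1} = γᵢ Σ_{ν=2}^{i+1} |F_ν/M| d(X⁽⁰⁾)^{ν−2}/(ν−1)! + 2|F_{i+2}/M|/(i+2)!` (`|F/M| = |F|/μ`,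
  `μ = min(|m₁|, |m₂|)`), `gammaSeq_nonneg`.
* `IsTaylorNewtonRun f m₁ m₂ p flo fhi ξ lo hi x wlo whi` — a run of (15) (`X⁽ᵏ⁾ = [lo k, hi k]`,
  `X⁽ᵏ⁺¹'ⁱ⁾ = [wlo k i, whi k i]`, arbitrary selection `x⁽ᵏ⁾ ∈ X⁽ᵏ⁾`) under the standing hypotheses
  `f ∈ C^{p+1}`, `f′(X⁽⁰⁾) ⊆ M = [m₁, m₂] ∌ 0` (⇒ the book's (2)), (14) `f⁽ᵛ⁾(X⁽⁰⁾) ⊆ F_v`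
  (`2 ≤ v ≤ p + 1`), and a zero `ξ ∈ X⁽⁰⁾` (the book's (1) `f(x₁⁽⁰⁾) < 0 < f(x₂⁽⁰⁾)` yields one); along it:
  **(16)** `root_mem`, `root_mem_inner`; **(17)** `succ_subset`, `width_succ_le`
  (`d(X⁽ᵏ⁺¹⁾) ≤ (1 − m₁/m₂) d(X⁽ᵏ⁾)` with `newtonFactor` of `…Contraction.lean`), `width_le_pow`,
  `tendsto_width/lo/hi`, `iInter_eq`, `rest_of_eval_eq_zero` (the run rests at `[ξ, ξ]` once
  `f(x⁽ᵏ⁾) = 0`), `eq_root_of_eval_eq_zero` (uniqueness); **(18)** `width_inner_le`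
  (`d(X⁽ᵏ⁺¹'ⁱ⁾) ≤ γᵢ d(X⁽ᵏ⁾)^{i+1}`, the book's induction), `width_succ_le_pow`
  (`d(X⁽ᵏ⁺¹⁾) ≤ γ_p d(X⁽ᵏ⁾)^{p+1}`); and `succ_le_ROrder_width` — the R-order of the width sequence is
  `≥ p + 1` (`ROrderConvergence.le_ROrder_of_le_mul_pow`); all packaged in `alefeldHerzberger_ch7_thm5`.

Modelling choices (honest deltas).  EXACT interval arithmetic throughout (the intersections ARE the
iterates); the powers `(X − x)ᵛ` of (15) are exact power ranges with independent occurrences — an outer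
(machine) evaluation keeps (16) by `taylorStep_mono`-style monotonicity but (18) is proved for the exact
evaluation only; `f ∈ C^{p+1}` globally rather than on `X⁽⁰⁾`; `f′(X⁽⁰⁾) ⊆ M` replaces (2) (stronger,
as in the `p = 1` file); the zero `ξ` is a datum of the run (fields `root`, `root_mem_zero`).
NOT formalised: the derivation of a zero from (1); the `v`-fold interval product variant of the powers;
Theorem 6 (the modification (19) with `M⁽ᵏ⁾`); the numerical example following Theorem 5.

Framing: filed by the engines group's CAP-3 lane (Lean Literature anchors) as a plain formalisation of a
PUBLISHED result; it certifies no engine output — shared numerical engines serving client cells; rigour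
lives in the verifiers; every published number belongs to a client cell's ledger, not to the engines group.
-/

set_option autoImplicit false

namespace Literature.Analysis.ValidatedNumerics.HigherOrderIntervalNewton

open Set Filter Topology Finset
open scoped Nat
open Literature.Analysis.ValidatedNumerics.IntervalNewton

/-- **The Taylor step of iteration (15)** producing `X⁽ᵏ⁺¹'ⁱ⁾` from `Y = X⁽ᵏ⁺¹'ⁱ⁻¹⁾` (`1 ≤ i ≤ p`):
the EXACT RANGE of
`x − (1/f'(x))·[f(x) + Σ_{v=2}^{i} f⁽ᵛ⁾(x)/v!·(y_v − x)ᵛ + e/(i+1)!·(y_{i+1} − x)^{i+1}]`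
over independent `y_2, …, y_{i+1} ∈ Y` and `e ∈ E = F_{i+1}` — i.e. the interval evaluation of the
bracket in (15) with every occurrence of `(Y − x)` independent and each power taken as an exact power
range (the sharpest interval evaluation of the book's expression; `f'(x) = deriv f x`,
`f⁽ᵛ⁾(x) = iteratedDeriv v f x`) [cite: AlefeldHerzberger1983, Ch. 7 §D Thm 5 (15)] -/
def taylorStep (f : ℝ → ℝ) (i : ℕ) (x : ℝ) (E Y : Set ℝ) : Set ℝ :=
  {z | ∃ e ∈ E, ∃ y : ℕ → ℝ, (∀ v, y v ∈ Y) ∧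
    z = x - (f x + (∑ v ∈ Finset.Ico 2 (i + 1), iteratedDeriv v f x / (v ! : ℝ) * (y v - x) ^ v)
      + e / ((i + 1) ! : ℝ) * (y (i + 1) - x) ^ (i + 1)) / deriv f x}

/-- Inclusion monotonicity of the Taylor step in `(E, Y)` [cite: AlefeldHerzberger1983, Ch. 7 §D Thm 5 (15), Ch. 1 (inclusion monotonicity)] -/
theorem taylorStep_mono {f : ℝ → ℝ} {i : ℕ} {x : ℝ} {E E' Y Y' : Set ℝ} (hE : E ⊆ E') (hY : Y ⊆ Y') :
    taylorStep f i x E Y ⊆ taylorStep f i x E' Y' := by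
  rintro z ⟨e, he, y, hy, rfl⟩
  exact ⟨e, hE he, y, fun v => hY (hy v), rfl⟩

/-- **Taylor's formula with Lagrange remainder, two-sided, in global iterated derivatives**: for
`f ∈ C^n`, `i + 1 ≤ n`, `x ≠ ξ`:
`f(ξ) = Σ_{v=0}^{i} f⁽ᵛ⁾(x)/v!·(ξ − x)ᵛ + f⁽ⁱ⁺¹⁾(η)/(i+1)!·(ξ − x)^{i+1}` for some `η` between `x` and `ξ`
(Mathlib's `taylor_mean_remainder_lagrange_iteratedDeriv` with the within-derivatives at `x`
identified with `iteratedDeriv`) [cite: AlefeldHerzberger1983, Ch. 7 §D Thm 5 (proof of (16), Taylor's formula)] -/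
theorem taylor_eq_sum_add {f : ℝ → ℝ} {n i : ℕ} (hf : ContDiff ℝ n f) (hin : i + 1 ≤ n) {x ξ : ℝ}
    (hne : x ≠ ξ) :
    ∃ η ∈ uIcc x ξ, f ξ = (∑ v ∈ Finset.range (i + 1), iteratedDeriv v f x / (v ! : ℝ) * (ξ - x) ^ v)
      + iteratedDeriv (i + 1) f η / ((i + 1)! : ℝ) * (ξ - x) ^ (i + 1) := by
  have hf' : ContDiff ℝ (i + 1) f := hf.of_le (by exact_mod_cast hin)
  obtain ⟨η, hη, hrem⟩ := taylor_mean_remainder_lagrange_iteratedDeriv hne hf'.contDiffOn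
  have hU : UniqueDiffOn ℝ (uIcc x ξ) := uniqueDiffOn_Icc (min_lt_max.2 hne)
  have htaylor : taylorWithinEval f i (uIcc x ξ) x ξ =
      ∑ v ∈ Finset.range (i + 1), iteratedDeriv v f x / (v ! : ℝ) * (ξ - x) ^ v := by
    rw [taylor_within_apply]
    refine Finset.sum_congr rfl fun v hv => ?_
    have hv' : (v : WithTop ℕ∞) ≤ (i + 1 : ℕ) := by
      exact_mod_cast (Finset.mem_range.1 hv).le
    rw [iteratedDerivWithin_eq_iteratedDeriv hU ((hf'.of_le (by exact_mod_cast (Finset.mem_range.1 hv).le)).contDiffAt) left_mem_uIcc]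
    simp only [smul_eq_mul]
    ring
  refine ⟨η, Ioo_subset_Icc_self hη, ?_⟩
  rw [htaylor] at hrem
  linear_combination hrem

/-- **(16), Taylor step: the zero survives.**  If `f ∈ C^n` (`i + 1 ≤ n`, `1 ≤ i`),
`f⁽ⁱ⁺¹⁾([a, b]) ⊆ E`, `x, ξ ∈ [a, b]`, `f(ξ) = 0`, `f'(x) ≠ 0` and `ξ ∈ Y`, then `ξ ∈ taylorStep f i x E Y` —
*"From Taylor's formula we get 0 = f(ξ) = f(x⁽ᵏ⁾) + f'(x⁽ᵏ⁾)(ξ − x⁽ᵏ⁾) + … ; inclusion monotonicity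
then gives us the relation ξ ∈ X⁽ᵏ⁺¹'ⁱ⁺¹⁾"* [cite: AlefeldHerzberger1983, Ch. 7 §D Thm 5 (16)] -/
theorem root_mem_taylorStep {f : ℝ → ℝ} {n i : ℕ} (hf : ContDiff ℝ n f) (hin : i + 1 ≤ n) (hi1 : 1 ≤ i)
    {a b x ξ : ℝ} {E Y : Set ℝ} (hE : ∀ t ∈ Icc a b, iteratedDeriv (i + 1) f t ∈ E)
    (hx : x ∈ Icc a b) (hξab : ξ ∈ Icc a b) (hξ : f ξ = 0) (hdx : deriv f x ≠ 0) (hξY : ξ ∈ Y) :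
    ξ ∈ taylorStep f i x E Y := by
  by_cases hne : x = ξ
  · subst hne
    refine ⟨iteratedDeriv (i + 1) f x, hE x hx, fun _ => x, fun _ => hξY, ?_⟩
    have h0 : ∀ v ∈ Finset.Ico 2 (i + 1), iteratedDeriv v f x / (v ! : ℝ) * (x - x) ^ v = 0 := by
      intro v hv
      have : v ≠ 0 := by have := (Finset.mem_Ico.1 hv).1; omega
      simp [this]
    rw [Finset.sum_eq_zero h0]
    simp [hξ]
  obtain ⟨η, hη, heq⟩ := taylor_eq_sum_add hf hin hne
  have hηab : η ∈ Icc a b := uIcc_subset_Icc hx hξab hη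
  refine ⟨iteratedDeriv (i + 1) f η, hE η hηab, fun _ => ξ, fun _ => hξY, ?_⟩
  rw [Finset.range_eq_Ico, Finset.sum_eq_sum_Ico_succ_bot (by omega),
    Finset.sum_eq_sum_Ico_succ_bot (by omega)] at heq
  simp only [iteratedDeriv_zero, iteratedDeriv_one, Nat.factorial_zero, Nat.factorial_one, Nat.cast_one,
    pow_zero, pow_one, div_one, mul_one, zero_add, Nat.reduceAdd] at heq
  rw [hξ] at heq
  rw [eq_sub_iff_add_eq, ← eq_sub_iff_add_eq', div_eq_iff hdx]
  linear_combination -heq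


/-- `v/v! = 1/(v−1)!` for `v ≥ 1` (private plumbing) [folklore]. -/
private theorem cast_div_factorial {v : ℕ} (hv : 1 ≤ v) :
    (v : ℝ) / (v ! : ℝ) = 1 / ((v - 1)! : ℝ) := by
  obtain ⟨u, rfl⟩ : ∃ u, v = u + 1 := ⟨v - 1, by omega⟩
  rw [Nat.add_sub_cancel, Nat.factorial_succ, Nat.cast_mul]
  have : (u ! : ℝ) ≠ 0 := by positivity
  field_simp

/-- **Width of one Taylor step (proof of (18), "using the rules for width from Chapter 2").**
With `μ ≤ |f'(x)|`, `|f⁽ᵛ⁾(x)| ≤ |F_v|` (`2 ≤ v ≤ i`), `|E| ≤ |F_{i+1}|`, `|y − x| ≤ r` on `Y` and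
`d(Y) ≤ w`: any two points of `taylorStep f i x E Y` are within
`(Σ_{v=2}^{i} |F_v| r^{v−1} w/(v−1)! + 2|F_{i+1}| r^{i+1}/(i+1)!)/μ`
(`d((Y − x)ᵛ) ≤ v r^{v−1} d(Y)`, `d(A) ≤ 2|A|` for the remainder term) [cite: AlefeldHerzberger1983, Ch. 7 §D Thm 5 (proof of (18))] [cite: AlefeldHerzberger1983, Ch. 2 (rules for the width)] -/
theorem abs_sub_le_of_mem_taylorStep {f : ℝ → ℝ} {i : ℕ} {x μ r w elo ehi : ℝ} {Fmag : ℕ → ℝ}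
    {Y : Set ℝ} (hμ : 0 < μ) (hμle : μ ≤ |deriv f x|)
    (hF : ∀ v ∈ Finset.Ico 2 (i + 1), |iteratedDeriv v f x| ≤ Fmag v)
    (hE : max |elo| |ehi| ≤ Fmag (i + 1)) (hr : ∀ y ∈ Y, |y - x| ≤ r)
    (hw : ∀ y ∈ Y, ∀ y' ∈ Y, |y - y'| ≤ w) {z z' : ℝ}
    (hz : z ∈ taylorStep f i x (Icc elo ehi) Y) (hz' : z' ∈ taylorStep f i x (Icc elo ehi) Y) :
    |z - z'| ≤ ((∑ v ∈ Finset.Ico 2 (i + 1), Fmag v / ((v - 1)! : ℝ) * r ^ (v - 1)) * w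
      + 2 * (Fmag (i + 1) / ((i + 1)! : ℝ)) * r ^ (i + 1)) / μ := by
  obtain ⟨e, he, y, hy, rfl⟩ := hz
  obtain ⟨e', he', y', hy', rfl⟩ := hz'
  set d := deriv f x with hd
  set c : ℕ → ℝ := fun v => iteratedDeriv v f x / (v ! : ℝ) with hc
  set S := ∑ v ∈ Finset.Ico 2 (i + 1), c v * (y v - x) ^ v with hS
  set S' := ∑ v ∈ Finset.Ico 2 (i + 1), c v * (y' v - x) ^ v with hS'
  set R := e / ((i + 1)! : ℝ) * (y (i + 1) - x) ^ (i + 1) with hR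
  set R' := e' / ((i + 1)! : ℝ) * (y' (i + 1) - x) ^ (i + 1) with hR'
  have hd0 : 0 < |d| := hμ.trans_le hμle
  have hd0' : d ≠ 0 := abs_pos.1 hd0
  have hdiff : x - (f x + S + R) / d - (x - (f x + S' + R') / d) = ((S' - S) + (R' - R)) / d := by
    field_simp
    ring
  have hSS : |S - S'| ≤ (∑ v ∈ Finset.Ico 2 (i + 1), Fmag v / ((v - 1)! : ℝ) * r ^ (v - 1)) * w := by
    rw [hS, hS', ← Finset.sum_sub_distrib, Finset.sum_mul]
    refine (Finset.abs_sum_le_sum_abs _ _).trans (Finset.sum_le_sum fun v hv => ?_)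
    have hv2 : 2 ≤ v := (Finset.mem_Ico.1 hv).1
    rw [← mul_sub, abs_mul]
    have hpow : |(y v - x) ^ v - (y' v - x) ^ v| ≤ w * v * r ^ (v - 1) := by
      have h := abs_pow_sub_pow_le (a := y v - x) (b := y' v - x) (n := v)
      have hmax : max |y v - x| |y' v - x| ≤ r := max_le (hr _ (hy v)) (hr _ (hy' v))
      have hmax0 : 0 ≤ max |y v - x| |y' v - x| := (abs_nonneg _).trans (le_max_left _ _)
      have hab : |y v - x - (y' v - x)| ≤ w := by
        rw [sub_sub_sub_cancel_right]; exact hw _ (hy v) _ (hy' v)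
      have hw0 : 0 ≤ w := (abs_nonneg _).trans hab
      have hr0 : 0 ≤ r := hmax0.trans hmax
      calc |(y v - x) ^ v - (y' v - x) ^ v|
          ≤ |y v - x - (y' v - x)| * v * max |y v - x| |y' v - x| ^ (v - 1) := h
        _ ≤ w * v * r ^ (v - 1) := by gcongr
    have hF0 : 0 ≤ Fmag v := (abs_nonneg _).trans (hF v hv)
    have hcv : |c v| ≤ Fmag v / (v ! : ℝ) := by
      rw [hc]; dsimp only
      rw [abs_div, Nat.abs_cast]
      exact div_le_div_of_nonneg_right (hF v hv) (by positivity)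
    have hfac : (v : ℝ) / (v ! : ℝ) = 1 / ((v - 1)! : ℝ) := cast_div_factorial (by omega)
    calc |c v| * |(y v - x) ^ v - (y' v - x) ^ v| ≤ Fmag v / (v ! : ℝ) * (w * v * r ^ (v - 1)) :=
          mul_le_mul hcv hpow (abs_nonneg _) (div_nonneg hF0 (by positivity))
      _ = Fmag v * ((v : ℝ) / (v ! : ℝ)) * r ^ (v - 1) * w := by ring
      _ = Fmag v / ((v - 1)! : ℝ) * r ^ (v - 1) * w := by rw [hfac]; ring
  have hRR : |R - R'| ≤ 2 * (Fmag (i + 1) / ((i + 1)! : ℝ)) * r ^ (i + 1) := by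
    have hb : ∀ (e₀ s : ℝ), e₀ ∈ Icc elo ehi → |s| ≤ r →
        |e₀ / ((i + 1)! : ℝ) * s ^ (i + 1)| ≤ Fmag (i + 1) / ((i + 1)! : ℝ) * r ^ (i + 1) := by
      intro e₀ s he₀ hs
      rw [abs_mul, abs_div, abs_pow, Nat.abs_cast]
      have he₀' : |e₀| ≤ Fmag (i + 1) := (abs_le_max_abs_abs he₀.1 he₀.2).trans hE
      have h1 : |e₀| / ((i + 1)! : ℝ) ≤ Fmag (i + 1) / ((i + 1)! : ℝ) :=
        div_le_div_of_nonneg_right he₀' (by positivity)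
      have h2 : |s| ^ (i + 1) ≤ r ^ (i + 1) := pow_le_pow_left₀ (abs_nonneg _) hs _
      exact mul_le_mul h1 h2 (by positivity) (div_nonneg ((abs_nonneg _).trans he₀') (by positivity))
    calc |R - R'| ≤ |R| + |R'| := abs_sub _ _
      _ ≤ Fmag (i + 1) / ((i + 1)! : ℝ) * r ^ (i + 1) + Fmag (i + 1) / ((i + 1)! : ℝ) * r ^ (i + 1) :=
          add_le_add (hb e _ he (hr _ (hy (i + 1)))) (hb e' _ he' (hr _ (hy' (i + 1))))
      _ = 2 * (Fmag (i + 1) / ((i + 1)! : ℝ)) * r ^ (i + 1) := by ring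
  rw [hdiff, abs_div]
  have hnum : |S' - S + (R' - R)| ≤ |S - S'| + |R - R'| := by
    rw [abs_sub_comm S S', abs_sub_comm R R']; exact abs_add_le _ _
  calc |S' - S + (R' - R)| / |d| ≤ (|S - S'| + |R - R'|) / |d| :=
        div_le_div_of_nonneg_right hnum (abs_nonneg _)
    _ ≤ (|S - S'| + |R - R'|) / μ := div_le_div_of_nonneg_left (by positivity) hμ hμle
    _ ≤ _ := div_le_div_of_nonneg_right (add_le_add hSS hRR) hμ.le


/-! ### The constants `γᵢ` of (18) -/

/-- **The book's constants `γᵢ` (proof of (18))**: `γ₀ = 1` (for `d(X⁽ᵏ⁺¹'⁰⁾) ≤ d(X⁽ᵏ⁾)`),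
`γ_{i+1} = (γᵢ·Σ_{ν=2}^{i+1} |F_ν| d(X⁽⁰⁾)^{ν−2}/(ν−1)! + 2|F_{i+2}|/(i+2)!)/μ` with `μ = min|M|`
(so `|F_ν/M| = |F_ν|/μ`; `γ₁ = |F₂/M|`) [cite: AlefeldHerzberger1983, Ch. 7 §D Thm 5, proof of (18)]. -/
noncomputable def gammaSeq (μ d₀ : ℝ) (F : ℕ → ℝ) : ℕ → ℝ
  | 0 => 1
  | i + 1 => (gammaSeq μ d₀ F i * (∑ v ∈ Finset.Ico 2 (i + 2), F v / ((v - 1)! : ℝ) * d₀ ^ (v - 2))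
      + 2 * (F (i + 2) / ((i + 2)! : ℝ))) / μ

/-- `γ₀ = 1` [cite: AlefeldHerzberger1983, Ch. 7 §D Thm 5, proof of (18)] -/
theorem gammaSeq_zero (μ d₀ : ℝ) (F : ℕ → ℝ) : gammaSeq μ d₀ F 0 = 1 := rfl

/-- The recursion `γ_{i+1} = (γᵢ Σ_{ν=2}^{i+1} |F_ν| d(X⁽⁰⁾)^{ν−2}/(ν−1)! + 2|F_{i+2}|/(i+2)!)/μ`
[cite: AlefeldHerzberger1983, Ch. 7 §D Thm 5, proof of (18)] -/
theorem gammaSeq_succ (μ d₀ : ℝ) (F : ℕ → ℝ) (i : ℕ) :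
    gammaSeq μ d₀ F (i + 1) = (gammaSeq μ d₀ F i *
      (∑ v ∈ Finset.Ico 2 (i + 2), F v / ((v - 1)! : ℝ) * d₀ ^ (v - 2)) + 2 * (F (i + 2) / ((i + 2)! : ℝ))) / μ :=
  rfl

/-- `γ₁ = |F₂|/μ = |F₂/M|` — the constant of the `p = 1` case (the tree's
`IsSecondOrderNewtonRun.width_succ_le_sq`) [cite: AlefeldHerzberger1983, Ch. 7 §D Thm 5, proof of (18), γ₁ = |F₂/M|] -/
theorem gammaSeq_one (μ d₀ : ℝ) (F : ℕ → ℝ) : gammaSeq μ d₀ F 1 = F 2 / μ := by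
  rw [gammaSeq_succ, gammaSeq_zero]
  simp [Nat.factorial]
  ring

/-- `γᵢ ≥ 0` (`μ > 0`, `d(X⁽⁰⁾) ≥ 0`, `|F_ν| ≥ 0`) — the `γ ≥ 0` of (18) [cite: AlefeldHerzberger1983, Ch. 7 §D Thm 5 (18)] -/
theorem gammaSeq_nonneg {μ d₀ : ℝ} {F : ℕ → ℝ} (hμ : 0 < μ) (hd₀ : 0 ≤ d₀) (hF : ∀ v, 0 ≤ F v) :
    ∀ i, 0 ≤ gammaSeq μ d₀ F i
  | 0 => by rw [gammaSeq_zero]; exact zero_le_one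
  | i + 1 => by
    rw [gammaSeq_succ]
    refine div_nonneg (add_nonneg (mul_nonneg (gammaSeq_nonneg hμ hd₀ hF i)
      (Finset.sum_nonneg fun v _ => ?_)) ?_) hμ.le
    · exact mul_nonneg (div_nonneg (hF v) (by positivity)) (pow_nonneg hd₀ _)
    · exact mul_nonneg zero_le_two (div_nonneg (hF _) (by positivity))

/-! ### Slope enclosure modulus -/

/-- `t ∈ [m₁, m₂] ∌ 0` ⇒ `min(|m₁|, |m₂|) ≤ |t|` and `0 < min(|m₁|, |m₂|)` (private plumbing) [folklore]. -/
private theorem modulus_le_and_pos {m₁ m₂ t : ℝ} (h0 : (0 : ℝ) ∉ Icc m₁ m₂) (ht : t ∈ Icc m₁ m₂) :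
    min |m₁| |m₂| ≤ |t| ∧ 0 < min |m₁| |m₂| := by
  have hle : m₁ ≤ m₂ := ht.1.trans ht.2
  rcases lt_or_ge 0 m₁ with h | h
  · rw [abs_of_pos h, abs_of_pos (h.trans_le hle), min_eq_left hle, abs_of_pos (h.trans_le ht.1)]
    exact ⟨ht.1, h⟩
  · have h' : m₂ < 0 := lt_of_not_ge fun h'' => h0 ⟨h, h''⟩
    rw [abs_of_neg (hle.trans_lt h'), abs_of_neg h', min_eq_right (neg_le_neg hle),
      abs_of_neg (ht.2.trans_lt h')]
    exact ⟨neg_le_neg ht.2, neg_pos.2 h'⟩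

/-! ### Iteration (15) for general `p ≥ 1` and Theorem 5 -/

/-- **A run of the always convergent higher-order method — iteration (15) for general `p ≥ 1`**,
in exact arithmetic:
```
x⁽ᵏ⁾ = m(X⁽ᵏ⁾) ∈ X⁽ᵏ⁾                                   (arbitrary selection),
X⁽ᵏ⁺¹'⁰⁾ = {x⁽ᵏ⁾ − f(x⁽ᵏ⁾)/M} ∩ X⁽ᵏ⁾,
X⁽ᵏ⁺¹'ⁱ⁾ = {x⁽ᵏ⁾ − (1/f'(x⁽ᵏ⁾))[f(x⁽ᵏ⁾) + Σ_{v=2}^{i} f⁽ᵛ⁾(x⁽ᵏ⁾)/v!·(X⁽ᵏ⁺¹'ⁱ⁻¹⁾ − x⁽ᵏ⁾)ᵛ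
              + F_{i+1}/(i+1)!·(X⁽ᵏ⁺¹'ⁱ⁻¹⁾ − x⁽ᵏ⁾)^{i+1}]} ∩ X⁽ᵏ⁺¹'ⁱ⁻¹⁾,   1 ≤ i ≤ p,
X⁽ᵏ⁺¹⁾ = X⁽ᵏ⁺¹'ᵖ⁾
```
(`Icc (wlo k i) (whi k i)` IS `X⁽ᵏ⁺¹'ⁱ⁾`, `Icc (lo k) (hi k)` IS `X⁽ᵏ⁾`), with the standing hypotheses:
`f ∈ C^{p+1}`; `f'(X⁽⁰⁾) ⊆ M = [m₁, m₂] ∌ 0` (which implies the book's (2) by the mean value theorem);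
(14) `f⁽ᵛ⁾(X⁽⁰⁾) ⊆ F_v = [flo v, fhi v]` for `2 ≤ v ≤ p + 1`; and a zero `ξ ∈ X⁽⁰⁾` (the book derives
it from (1) `f(x₁⁽⁰⁾) < 0 < f(x₂⁽⁰⁾)`) [cite: AlefeldHerzberger1983, Ch. 7 §D Thm 5, (15), (14), (1), (2)] -/
structure IsTaylorNewtonRun (f : ℝ → ℝ) (m₁ m₂ : ℝ) (p : ℕ) (flo fhi : ℕ → ℝ) (ξ : ℝ)
    (lo hi x : ℕ → ℝ) (wlo whi : ℕ → ℕ → ℝ) : Prop where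
  contDiff : ContDiff ℝ (p + 1) f
  one_le : 1 ≤ p
  zero_not_mem : (0 : ℝ) ∉ Icc m₁ m₂
  deriv_mem : ∀ t ∈ Icc (lo 0) (hi 0), deriv f t ∈ Icc m₁ m₂
  iteratedDeriv_mem : ∀ v, 2 ≤ v → v ≤ p + 1 → ∀ t ∈ Icc (lo 0) (hi 0),
    iteratedDeriv v f t ∈ Icc (flo v) (fhi v)
  root : f ξ = 0
  root_mem_zero : ξ ∈ Icc (lo 0) (hi 0)
  point_mem : ∀ k, lo k ≤ hi k → x k ∈ Icc (lo k) (hi k)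
  inner_zero : ∀ k, Icc (wlo k 0) (whi k 0) = Icc (lo k) (hi k) ∩ newtonSet (x k) (f (x k)) (Icc m₁ m₂)
  inner_succ : ∀ k i, i < p → Icc (wlo k (i + 1)) (whi k (i + 1)) =
    taylorStep f (i + 1) (x k) (Icc (flo (i + 2)) (fhi (i + 2))) (Icc (wlo k i) (whi k i)) ∩
      Icc (wlo k i) (whi k i)
  succ_eq : ∀ k, Icc (lo (k + 1)) (hi (k + 1)) = Icc (wlo k p) (whi k p)

namespace IsTaylorNewtonRun

variable {f : ℝ → ℝ} {m₁ m₂ : ℝ} {p : ℕ} {flo fhi : ℕ → ℝ} {ξ : ℝ} {lo hi x : ℕ → ℝ}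
  {wlo whi : ℕ → ℕ → ℝ}

/-- `X⁽ᵏ⁺¹'⁰⁾ ⊆ X⁽ᵏ⁾` [cite: AlefeldHerzberger1983, Ch. 7 §D Thm 5 (17)] -/
theorem inner_zero_subset (hr : IsTaylorNewtonRun f m₁ m₂ p flo fhi ξ lo hi x wlo whi) (k : ℕ) :
    Icc (wlo k 0) (whi k 0) ⊆ Icc (lo k) (hi k) := by
  rw [hr.inner_zero k]; exact inter_subset_left

/-- `X⁽ᵏ⁺¹'ⁱ⁺¹⁾ ⊆ X⁽ᵏ⁺¹'ⁱ⁾` — *"since we take intersections in method (15)"* [cite: AlefeldHerzberger1983, Ch. 7 §D Thm 5 (17)] -/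
theorem inner_succ_subset (hr : IsTaylorNewtonRun f m₁ m₂ p flo fhi ξ lo hi x wlo whi) (k : ℕ)
    {i : ℕ} (hip : i < p) : Icc (wlo k (i + 1)) (whi k (i + 1)) ⊆ Icc (wlo k i) (whi k i) := by
  rw [hr.inner_succ k i hip]; exact inter_subset_right

/-- `X⁽ᵏ⁺¹'ⁱ⁺¹⁾` lies in the Taylor step set built on `X⁽ᵏ⁺¹'ⁱ⁾` [cite: AlefeldHerzberger1983, Ch. 7 §D Thm 5 (15)] -/
theorem inner_succ_subset_taylorStep (hr : IsTaylorNewtonRun f m₁ m₂ p flo fhi ξ lo hi x wlo whi)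
    (k : ℕ) {i : ℕ} (hip : i < p) : Icc (wlo k (i + 1)) (whi k (i + 1)) ⊆
      taylorStep f (i + 1) (x k) (Icc (flo (i + 2)) (fhi (i + 2))) (Icc (wlo k i) (whi k i)) := by
  rw [hr.inner_succ k i hip]; exact inter_subset_left

/-- `X⁽ᵏ⁺¹'ⁱ⁾ ⊆ X⁽ᵏ⁾` for `i ≤ p` [cite: AlefeldHerzberger1983, Ch. 7 §D Thm 5 (17)] -/
theorem inner_subset (hr : IsTaylorNewtonRun f m₁ m₂ p flo fhi ξ lo hi x wlo whi) (k : ℕ) :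
    ∀ {i : ℕ}, i ≤ p → Icc (wlo k i) (whi k i) ⊆ Icc (lo k) (hi k)
  | 0, _ => hr.inner_zero_subset k
  | _ + 1, hip => (hr.inner_succ_subset k hip).trans (hr.inner_subset k (Nat.le_of_succ_le hip))

/-- **(17), nesting: `X⁽ᵏ⁺¹⁾ ⊆ X⁽ᵏ⁾`** [cite: AlefeldHerzberger1983, Ch. 7 §D Thm 5 (17)] -/
theorem succ_subset (hr : IsTaylorNewtonRun f m₁ m₂ p flo fhi ξ lo hi x wlo whi) (k : ℕ) :
    Icc (lo (k + 1)) (hi (k + 1)) ⊆ Icc (lo k) (hi k) := by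
  rw [hr.succ_eq k]; exact hr.inner_subset k le_rfl

/-- `X⁽ᵏ⁾ ⊆ X⁽⁰⁾` [cite: AlefeldHerzberger1983, Ch. 7 §D Thm 5 (17)] -/
theorem subset_zero (hr : IsTaylorNewtonRun f m₁ m₂ p flo fhi ξ lo hi x wlo whi) :
    ∀ k, Icc (lo k) (hi k) ⊆ Icc (lo 0) (hi 0)
  | 0 => Subset.rfl
  | k + 1 => (hr.succ_subset k).trans (hr.subset_zero k)

/-- `m₁ ≤ m₂` (`M ∋ f'(ξ)` is nonempty) [cite: AlefeldHerzberger1983, Ch. 7 §D Thm 5 (2)] -/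
theorem m_le (hr : IsTaylorNewtonRun f m₁ m₂ p flo fhi ξ lo hi x wlo whi) : m₁ ≤ m₂ :=
  (hr.deriv_mem ξ hr.root_mem_zero).1.trans (hr.deriv_mem ξ hr.root_mem_zero).2

/-- `f` is differentiable with derivative `deriv f` (`f ∈ C^{p+1}`, `p + 1 ≥ 1`) [cite: AlefeldHerzberger1983, Ch. 7 §D Thm 5 (hypothesis: f (p+1)-times continuously differentiable)] -/
theorem hasDerivAt (hr : IsTaylorNewtonRun f m₁ m₂ p flo fhi ξ lo hi x wlo whi) (t : ℝ) :
    HasDerivAt f (deriv f t) t :=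
  ((hr.contDiff.differentiable (by simp)).differentiableAt).hasDerivAt

/-- `f'(t) ≠ 0` on `X⁽⁰⁾` (`f'(X⁽⁰⁾) ⊆ M ∌ 0`) [cite: AlefeldHerzberger1983, Ch. 7 §D Thm 5 (2)] -/
theorem deriv_ne_zero (hr : IsTaylorNewtonRun f m₁ m₂ p flo fhi ξ lo hi x wlo whi) {t : ℝ}
    (ht : t ∈ Icc (lo 0) (hi 0)) : deriv f t ≠ 0 := fun h =>
  hr.zero_not_mem (h ▸ hr.deriv_mem t ht)

/-- **(16), inner induction**: `ξ ∈ X⁽ᵏ⁾ ⇒ ξ ∈ X⁽ᵏ⁺¹'ⁱ⁾` for `0 ≤ i ≤ p` — the half-step by the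
mean value theorem *"as in Theorem 1"*, the Taylor steps by `root_mem_taylorStep` [cite: AlefeldHerzberger1983, Ch. 7 §D Thm 5 (16)] [cite: Moore1979, §5.2 Thm 5.5] -/
theorem root_mem_inner_of (hr : IsTaylorNewtonRun f m₁ m₂ p flo fhi ξ lo hi x wlo whi) {k : ℕ}
    (hk : ξ ∈ Icc (lo k) (hi k)) : ∀ {i : ℕ}, i ≤ p → ξ ∈ Icc (wlo k i) (whi k i)
  | 0, _ => by
    have hx0 : x k ∈ Icc (lo 0) (hi 0) := hr.subset_zero k (hr.point_mem k (hk.1.trans hk.2))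
    rw [hr.inner_zero k]
    exact ⟨hk, zero_mem_newtonSet (fun t _ => hr.hasDerivAt t) hr.deriv_mem hr.zero_not_mem hx0
      (hr.subset_zero k hk) hr.root⟩
  | i + 1, hip => by
    have hξi := hr.root_mem_inner_of hk (Nat.le_of_succ_le hip)
    have hx0 : x k ∈ Icc (lo 0) (hi 0) := hr.subset_zero k (hr.point_mem k (hk.1.trans hk.2))
    rw [hr.inner_succ k i hip]
    refine ⟨root_mem_taylorStep (n := p + 1) (i := i + 1) hr.contDiff (by omega) (by omega)
      (fun t ht => hr.iteratedDeriv_mem (i + 2) (by omega) (by omega) t ht) hx0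
      (hr.subset_zero k hk) hr.root (hr.deriv_ne_zero hx0) hξi, hξi⟩

/-- **(16): `ξ ∈ X⁽ᵏ⁾` for all `k ≥ 0`** [cite: AlefeldHerzberger1983, Ch. 7 §D Thm 5 (16)] -/
theorem root_mem (hr : IsTaylorNewtonRun f m₁ m₂ p flo fhi ξ lo hi x wlo whi) :
    ∀ k, ξ ∈ Icc (lo k) (hi k)
  | 0 => hr.root_mem_zero
  | k + 1 => by rw [hr.succ_eq k]; exact hr.root_mem_inner_of (hr.root_mem k) le_rfl

/-- **(16)**: `ξ ∈ X⁽ᵏ⁺¹'ⁱ⁾`, `0 ≤ i ≤ p` [cite: AlefeldHerzberger1983, Ch. 7 §D Thm 5 (16)] -/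
theorem root_mem_inner (hr : IsTaylorNewtonRun f m₁ m₂ p flo fhi ξ lo hi x wlo whi) (k : ℕ) {i : ℕ}
    (hip : i ≤ p) : ξ ∈ Icc (wlo k i) (whi k i) :=
  hr.root_mem_inner_of (hr.root_mem k) hip

/-- `X⁽ᵏ⁾ ≠ ∅` [cite: AlefeldHerzberger1983, Ch. 7 §D Thm 5 (16)] -/
theorem lo_le_hi (hr : IsTaylorNewtonRun f m₁ m₂ p flo fhi ξ lo hi x wlo whi) (k : ℕ) :
    lo k ≤ hi k :=
  (hr.root_mem k).1.trans (hr.root_mem k).2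

/-- `X⁽ᵏ⁺¹'ⁱ⁾ ≠ ∅` (`i ≤ p`) [cite: AlefeldHerzberger1983, Ch. 7 §D Thm 5 (16)] -/
theorem wlo_le_whi (hr : IsTaylorNewtonRun f m₁ m₂ p flo fhi ξ lo hi x wlo whi) (k : ℕ) {i : ℕ}
    (hip : i ≤ p) : wlo k i ≤ whi k i :=
  (hr.root_mem_inner k hip).1.trans (hr.root_mem_inner k hip).2

/-- `x⁽ᵏ⁾ ∈ X⁽ᵏ⁾` [cite: AlefeldHerzberger1983, Ch. 7 §D Thm 5 (15)] -/
theorem point_mem_self (hr : IsTaylorNewtonRun f m₁ m₂ p flo fhi ξ lo hi x wlo whi) (k : ℕ) :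
    x k ∈ Icc (lo k) (hi k) :=
  hr.point_mem k (hr.lo_le_hi k)

/-- `x⁽ᵏ⁾ ∈ X⁽⁰⁾` [cite: AlefeldHerzberger1983, Ch. 7 §D Thm 5 (15), (17)] -/
theorem point_mem_zero (hr : IsTaylorNewtonRun f m₁ m₂ p flo fhi ξ lo hi x wlo whi) (k : ℕ) :
    x k ∈ Icc (lo 0) (hi 0) :=
  hr.subset_zero k (hr.point_mem_self k)

/-- **(17), quantitative, half-step: `d(X⁽ᵏ⁺¹'⁰⁾) ≤ (1 − m₁/m₂)·d(X⁽ᵏ⁾)`** (*"in the same manner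
as in Theorem 1"*; `newtonFactor m₁ m₂ = 1 − min|M|/max|M|`, arbitrary selection point) [cite: AlefeldHerzberger1983, Ch. 7 §D Thm 5 (17), Thm 1 (7)] -/
theorem width_inner_zero_le (hr : IsTaylorNewtonRun f m₁ m₂ p flo fhi ξ lo hi x wlo whi) (k : ℕ) :
    whi k 0 - wlo k 0 ≤ newtonFactor m₁ m₂ * (hi k - lo k) := by
  have hk := hr.wlo_le_whi k (Nat.zero_le p)
  have hmem : ∀ z ∈ Icc (wlo k 0) (whi k 0),
      z ∈ Icc (lo k) (hi k) ∩ newtonSet (x k) (f (x k)) (Icc m₁ m₂) := by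
    intro z hz; rwa [← hr.inner_zero k]
  have habs := abs_sub_le_newtonFactor_mul_width_of_mem_inter_newtonSet hr.m_le hr.zero_not_mem
    (hr.point_mem_self k) (hmem _ (right_mem_Icc.2 hk)) (hmem _ (left_mem_Icc.2 hk))
  rwa [abs_of_nonneg (sub_nonneg.2 hk)] at habs

/-- `d(X⁽ᵏ⁺¹'ⁱ⁾) ≤ d(X⁽ᵏ⁾)` (`i ≤ p`; for `i = 0` the first line of the proof of (18)) [cite: AlefeldHerzberger1983, Ch. 7 §D Thm 5, proof of (18)] -/
theorem width_inner_le_width (hr : IsTaylorNewtonRun f m₁ m₂ p flo fhi ξ lo hi x wlo whi) (k : ℕ)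
    {i : ℕ} (hip : i ≤ p) : whi k i - wlo k i ≤ hi k - lo k := by
  obtain ⟨h1, h2⟩ := (Icc_subset_Icc_iff (hr.wlo_le_whi k hip)).1 (hr.inner_subset k hip)
  linarith

/-- `X⁽ᵏ⁺¹'ʲ⁾ ⊆ X⁽ᵏ⁺¹'ⁱ⁾` for `i ≤ j ≤ p` [cite: AlefeldHerzberger1983, Ch. 7 §D Thm 5 (17)] -/
theorem inner_subset_inner (hr : IsTaylorNewtonRun f m₁ m₂ p flo fhi ξ lo hi x wlo whi) (k : ℕ) :
    ∀ {j : ℕ}, j ≤ p → ∀ {i : ℕ}, i ≤ j → Icc (wlo k j) (whi k j) ⊆ Icc (wlo k i) (whi k i)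
  | 0, _, i, hij => by rw [Nat.le_zero.1 hij]
  | j + 1, hj, i, hij => by
    rcases Nat.lt_or_ge i (j + 1) with h | h
    · exact (hr.inner_succ_subset k hj).trans (hr.inner_subset_inner k (Nat.le_of_succ_le hj)
        (Nat.lt_succ_iff.1 h))
    · rw [le_antisymm hij h]

/-- `X⁽ᵏ⁺¹⁾ ⊆ X⁽ᵏ⁺¹'⁰⁾` [cite: AlefeldHerzberger1983, Ch. 7 §D Thm 5 (17)] -/
theorem succ_subset_inner_zero (hr : IsTaylorNewtonRun f m₁ m₂ p flo fhi ξ lo hi x wlo whi) (k : ℕ) :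
    Icc (lo (k + 1)) (hi (k + 1)) ⊆ Icc (wlo k 0) (whi k 0) := by
  rw [hr.succ_eq k]; exact hr.inner_subset_inner k le_rfl (Nat.zero_le p)

/-- **(17), quantitative: `d(X⁽ᵏ⁺¹⁾) ≤ (1 − m₁/m₂)·d(X⁽ᵏ⁾)`, `k ≥ 0`** [cite: AlefeldHerzberger1983, Ch. 7 §D Thm 5 (17)] -/
theorem width_succ_le (hr : IsTaylorNewtonRun f m₁ m₂ p flo fhi ξ lo hi x wlo whi) (k : ℕ) :
    hi (k + 1) - lo (k + 1) ≤ newtonFactor m₁ m₂ * (hi k - lo k) := by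
  obtain ⟨h1, h2⟩ := (Icc_subset_Icc_iff (hr.lo_le_hi (k + 1))).1 (hr.succ_subset_inner_zero k)
  linarith [hr.width_inner_zero_le k]

/-- **Linear convergence `d(X⁽ᵏ⁾) ≤ (1 − m₁/m₂)ᵏ d(X⁽⁰⁾)`** (as in Theorem 1 (6)) [cite: AlefeldHerzberger1983, Ch. 7 §D Thm 5 (17), Thm 1 (6)] -/
theorem width_le_pow (hr : IsTaylorNewtonRun f m₁ m₂ p flo fhi ξ lo hi x wlo whi) :
    ∀ k, hi k - lo k ≤ newtonFactor m₁ m₂ ^ k * (hi 0 - lo 0)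
  | 0 => by simp
  | k + 1 => by
    calc hi (k + 1) - lo (k + 1) ≤ newtonFactor m₁ m₂ * (hi k - lo k) := hr.width_succ_le k
      _ ≤ newtonFactor m₁ m₂ * (newtonFactor m₁ m₂ ^ k * (hi 0 - lo 0)) :=
          mul_le_mul_of_nonneg_left (hr.width_le_pow k) (newtonFactor_nonneg hr.m_le)
      _ = newtonFactor m₁ m₂ ^ (k + 1) * (hi 0 - lo 0) := by ring

/-- **(17): `d(X⁽ᵏ⁾) → 0`** [cite: AlefeldHerzberger1983, Ch. 7 §D Thm 5 (17)] -/
theorem tendsto_width (hr : IsTaylorNewtonRun f m₁ m₂ p flo fhi ξ lo hi x wlo whi) :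
    Tendsto (fun k => hi k - lo k) atTop (𝓝 0) := by
  have hpow : Tendsto (fun k => newtonFactor m₁ m₂ ^ k * (hi 0 - lo 0)) atTop (𝓝 0) := by
    simpa using (tendsto_pow_atTop_nhds_zero_of_lt_one (newtonFactor_nonneg hr.m_le)
      (newtonFactor_lt_one hr.m_le hr.zero_not_mem)).mul_const (hi 0 - lo 0)
  exact tendsto_of_tendsto_of_tendsto_of_le_of_le tendsto_const_nhds hpow
    (fun k => sub_nonneg.2 (hr.lo_le_hi k)) (fun k => hr.width_le_pow k)

/-- **(17): `lim X⁽ᵏ⁾ = ξ`, lower endpoints** [cite: AlefeldHerzberger1983, Ch. 7 §D Thm 5 (17)] -/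
theorem tendsto_lo (hr : IsTaylorNewtonRun f m₁ m₂ p flo fhi ξ lo hi x wlo whi) :
    Tendsto lo atTop (𝓝 ξ) := by
  have h1 : Tendsto (fun k => ξ - (hi k - lo k)) atTop (𝓝 ξ) := by
    simpa using (tendsto_const_nhds : Tendsto (fun _ : ℕ => ξ) atTop (𝓝 ξ)).sub hr.tendsto_width
  refine tendsto_of_tendsto_of_tendsto_of_le_of_le h1 tendsto_const_nhds (fun k => ?_) (fun k => ?_)
  · have hk := hr.root_mem k
    show ξ - (hi k - lo k) ≤ lo k
    linarith [hk.1, hk.2]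
  · exact (hr.root_mem k).1

/-- **(17): `lim X⁽ᵏ⁾ = ξ`, upper endpoints** [cite: AlefeldHerzberger1983, Ch. 7 §D Thm 5 (17)] -/
theorem tendsto_hi (hr : IsTaylorNewtonRun f m₁ m₂ p flo fhi ξ lo hi x wlo whi) :
    Tendsto hi atTop (𝓝 ξ) := by
  have h1 : Tendsto (fun k => ξ + (hi k - lo k)) atTop (𝓝 ξ) := by
    simpa using (tendsto_const_nhds : Tendsto (fun _ : ℕ => ξ) atTop (𝓝 ξ)).add hr.tendsto_width
  refine tendsto_of_tendsto_of_tendsto_of_le_of_le tendsto_const_nhds h1 (fun k => ?_) (fun k => ?_)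
  · exact (hr.root_mem k).2
  · have hk := hr.root_mem k
    show hi k ≤ ξ + (hi k - lo k)
    linarith [hk.1, hk.2]

/-- **(17): `⋂ₖ X⁽ᵏ⁾ = {ξ}`** [cite: AlefeldHerzberger1983, Ch. 7 §D Thm 5 (16)–(17)] -/
theorem iInter_eq (hr : IsTaylorNewtonRun f m₁ m₂ p flo fhi ξ lo hi x wlo whi) :
    (⋂ k, Icc (lo k) (hi k)) = {ξ} := by
  refine Subset.antisymm (fun z hz => ?_) (fun z hz => ?_)
  · rw [mem_iInter] at hz
    have hb : ∀ k, |z - ξ| ≤ hi k - lo k := fun k => by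
      have h1 := hz k
      have h2 := hr.root_mem k
      rw [abs_le]; constructor <;> linarith [h1.1, h1.2, h2.1, h2.2]
    have h0 : |z - ξ| ≤ 0 := ge_of_tendsto' hr.tendsto_width hb
    exact mem_singleton_iff.2 (sub_eq_zero.1 (abs_nonpos_iff.1 h0))
  · rw [mem_singleton_iff.1 hz]
    exact mem_iInter.2 fun k => hr.root_mem k

/-- `ξ` is the only zero of `f` in `X⁽⁰⁾` (`f'(X⁽⁰⁾) ⊆ M ∌ 0`) [cite: AlefeldHerzberger1983, Ch. 7 §D Thm 5] [cite: Moore1979, §5.2 Thm 5.5] -/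
theorem eq_root_of_eval_eq_zero (hr : IsTaylorNewtonRun f m₁ m₂ p flo fhi ξ lo hi x wlo whi) {ζ : ℝ}
    (hζ : ζ ∈ Icc (lo 0) (hi 0)) (hfζ : f ζ = 0) : ζ = ξ :=
  zero_unique_of_deriv_enclosure (fun t _ => hr.hasDerivAt t) hr.deriv_mem hr.zero_not_mem hζ
    hr.root_mem_zero hfζ hr.root

/-- `|y − x⁽ᵏ⁾| ≤ d(X⁽ᵏ⁾)` for `y ∈ X⁽ᵏ⁺¹'ⁱ⁾` (`|X⁽ᵏ⁺¹'ⁱ⁾ − x⁽ᵏ⁾| ≤ d(X⁽ᵏ⁾)`) [cite: AlefeldHerzberger1983, Ch. 7 §D Thm 5, proof of (18)] -/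
theorem abs_sub_point_le (hr : IsTaylorNewtonRun f m₁ m₂ p flo fhi ξ lo hi x wlo whi) (k : ℕ) {i : ℕ}
    (hip : i ≤ p) {y : ℝ} (hy : y ∈ Icc (wlo k i) (whi k i)) : |y - x k| ≤ hi k - lo k := by
  have hy' := hr.inner_subset k hip hy
  have hx := hr.point_mem_self k
  rw [abs_le]; constructor <;> linarith [hy'.1, hy'.2, hx.1, hx.2]

/-- `0 < μ = min(|m₁|, |m₂|)` (`|1/M| = 1/μ`) [cite: AlefeldHerzberger1983, Ch. 7 §D Thm 5, proof of (18)] -/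
theorem modulus_pos (hr : IsTaylorNewtonRun f m₁ m₂ p flo fhi ξ lo hi x wlo whi) :
    0 < min |m₁| |m₂| :=
  (modulus_le_and_pos hr.zero_not_mem (hr.deriv_mem ξ hr.root_mem_zero)).2

/-- `μ ≤ |f'(x⁽ᵏ⁾)|` (`f'(x⁽ᵏ⁾) ∈ M`) [cite: AlefeldHerzberger1983, Ch. 7 §D Thm 5, proof of (18)] -/
theorem modulus_le (hr : IsTaylorNewtonRun f m₁ m₂ p flo fhi ξ lo hi x wlo whi) (k : ℕ) :
    min |m₁| |m₂| ≤ |deriv f (x k)| :=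
  (modulus_le_and_pos hr.zero_not_mem (hr.deriv_mem (x k) (hr.point_mem_zero k))).1

/-- **Proof of (18), one Taylor step along the run**:
`d(X⁽ᵏ⁺¹'ⁱ⁺¹⁾) ≤ (Σ_{v=2}^{i+1} |F_v| d(X⁽ᵏ⁾)^{v−1} d(X⁽ᵏ⁺¹'ⁱ⁾)/(v−1)! + 2|F_{i+2}| d(X⁽ᵏ⁾)^{i+2}/(i+2)!)/μ` [cite: AlefeldHerzberger1983, Ch. 7 §D Thm 5, proof of (18)] -/
theorem width_inner_succ_le (hr : IsTaylorNewtonRun f m₁ m₂ p flo fhi ξ lo hi x wlo whi) (k : ℕ)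
    {i : ℕ} (hip : i < p) :
    whi k (i + 1) - wlo k (i + 1) ≤
      ((∑ v ∈ Finset.Ico 2 (i + 2), max |flo v| |fhi v| / ((v - 1)! : ℝ) * (hi k - lo k) ^ (v - 1)) *
          (whi k i - wlo k i) +
        2 * (max |flo (i + 2)| |fhi (i + 2)| / ((i + 2)! : ℝ)) * (hi k - lo k) ^ (i + 2)) /
        min |m₁| |m₂| := by
  have hk := hr.wlo_le_whi k hip
  have hsub := hr.inner_succ_subset_taylorStep k hip
  have h := abs_sub_le_of_mem_taylorStep (i := i + 1) (Fmag := fun v => max |flo v| |fhi v|)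
    (Y := Icc (wlo k i) (whi k i)) (r := hi k - lo k) (w := whi k i - wlo k i) hr.modulus_pos
    (hr.modulus_le k) (fun v hv => ?_) le_rfl (fun y hy => hr.abs_sub_point_le k hip.le hy)
    (fun y hy y' hy' => ?_) (hsub (right_mem_Icc.2 hk)) (hsub (left_mem_Icc.2 hk))
  · rwa [abs_of_nonneg (sub_nonneg.2 hk)] at h
  · have hv := Finset.mem_Ico.1 hv
    have hm := hr.iteratedDeriv_mem v hv.1 (by omega) (x k) (hr.point_mem_zero k)
    exact abs_le_max_abs_abs hm.1 hm.2
  · rw [abs_le]; constructor <;> linarith [hy.1, hy.2, hy'.1, hy'.2]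

/-- **Proof of (18), the induction: `d(X⁽ᵏ⁺¹'ⁱ⁾) ≤ γᵢ·d(X⁽ᵏ⁾)^{i+1}`, `0 ≤ i ≤ p`**, with the
book's `γᵢ` (`gammaSeq`, independent of `k`) [cite: AlefeldHerzberger1983, Ch. 7 §D Thm 5, proof of (18)] -/
theorem width_inner_le (hr : IsTaylorNewtonRun f m₁ m₂ p flo fhi ξ lo hi x wlo whi) (k : ℕ) :
    ∀ {i : ℕ}, i ≤ p → whi k i - wlo k i ≤
      gammaSeq (min |m₁| |m₂|) (hi 0 - lo 0) (fun v => max |flo v| |fhi v|) i * (hi k - lo k) ^ (i + 1)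
  | 0, _ => by
    rw [gammaSeq_zero, one_mul, zero_add, pow_one]
    exact hr.width_inner_le_width k (Nat.zero_le p)
  | i + 1, hip => by
    set μ := min |m₁| |m₂| with hμ
    set F : ℕ → ℝ := fun v => max |flo v| |fhi v| with hFdef
    set d := hi k - lo k with hd
    set d₀ := hi 0 - lo 0 with hd₀
    have hμ0 : 0 < μ := hr.modulus_pos
    have hF0 : ∀ v, 0 ≤ F v := fun v => (abs_nonneg _).trans (le_max_left _ _)
    have hd0 : 0 ≤ d := sub_nonneg.2 (hr.lo_le_hi k)
    have hdd₀ : d ≤ d₀ := by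
      obtain ⟨h1, h2⟩ := (Icc_subset_Icc_iff (hr.lo_le_hi k)).1 (hr.subset_zero k)
      rw [hd, hd₀]; linarith
    have hd₀0 : 0 ≤ d₀ := hd0.trans hdd₀
    have hγ0 := gammaSeq_nonneg hμ0 hd₀0 hF0 i
    have ih := hr.width_inner_le k (Nat.le_of_succ_le hip)
    have hstep := hr.width_inner_succ_le k hip
    have hS0 : 0 ≤ ∑ v ∈ Finset.Ico 2 (i + 2), F v / ((v - 1)! : ℝ) * d ^ (v - 1) :=
      Finset.sum_nonneg fun v _ => mul_nonneg (div_nonneg (hF0 v) (by positivity)) (pow_nonneg hd0 _)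
    have hterm : ∀ v ∈ Finset.Ico 2 (i + 2), F v / ((v - 1)! : ℝ) * d ^ (v - 1) *
        (gammaSeq μ d₀ F i * d ^ (i + 1)) ≤ gammaSeq μ d₀ F i * (F v / ((v - 1)! : ℝ) * d₀ ^ (v - 2)) *
          d ^ (i + 2) := by
      intro v hv
      have hv2 : 2 ≤ v := (Finset.mem_Ico.1 hv).1
      have hpow : d ^ (v - 1) * d ^ (i + 1) = d ^ (v - 2) * d ^ (i + 2) := by
        rw [← pow_add, ← pow_add]; congr 1; omega
      calc F v / ((v - 1)! : ℝ) * d ^ (v - 1) * (gammaSeq μ d₀ F i * d ^ (i + 1))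
          = gammaSeq μ d₀ F i * (F v / ((v - 1)! : ℝ)) * (d ^ (v - 1) * d ^ (i + 1)) := by ring
        _ = gammaSeq μ d₀ F i * (F v / ((v - 1)! : ℝ)) * (d ^ (v - 2) * d ^ (i + 2)) := by rw [hpow]
        _ ≤ gammaSeq μ d₀ F i * (F v / ((v - 1)! : ℝ)) * (d₀ ^ (v - 2) * d ^ (i + 2)) :=
            mul_le_mul_of_nonneg_left (mul_le_mul_of_nonneg_right (pow_le_pow_left₀ hd0 hdd₀ _)
              (pow_nonneg hd0 _)) (mul_nonneg hγ0 (div_nonneg (hF0 v) (by positivity)))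
        _ = gammaSeq μ d₀ F i * (F v / ((v - 1)! : ℝ) * d₀ ^ (v - 2)) * d ^ (i + 2) := by ring
    have hsum : (∑ v ∈ Finset.Ico 2 (i + 2), F v / ((v - 1)! : ℝ) * d ^ (v - 1)) *
        (gammaSeq μ d₀ F i * d ^ (i + 1)) ≤ gammaSeq μ d₀ F i *
          (∑ v ∈ Finset.Ico 2 (i + 2), F v / ((v - 1)! : ℝ) * d₀ ^ (v - 2)) * d ^ (i + 2) := by
      rw [Finset.sum_mul, Finset.mul_sum, Finset.sum_mul]
      exact Finset.sum_le_sum hterm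
    calc whi k (i + 1) - wlo k (i + 1)
        ≤ ((∑ v ∈ Finset.Ico 2 (i + 2), F v / ((v - 1)! : ℝ) * d ^ (v - 1)) * (whi k i - wlo k i) +
            2 * (F (i + 2) / ((i + 2)! : ℝ)) * d ^ (i + 2)) / μ := hstep
      _ ≤ ((∑ v ∈ Finset.Ico 2 (i + 2), F v / ((v - 1)! : ℝ) * d ^ (v - 1)) *
            (gammaSeq μ d₀ F i * d ^ (i + 1)) + 2 * (F (i + 2) / ((i + 2)! : ℝ)) * d ^ (i + 2)) / μ := by
          gcongr
      _ ≤ (gammaSeq μ d₀ F i * (∑ v ∈ Finset.Ico 2 (i + 2), F v / ((v - 1)! : ℝ) * d₀ ^ (v - 2)) *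
            d ^ (i + 2) + 2 * (F (i + 2) / ((i + 2)! : ℝ)) * d ^ (i + 2)) / μ := by
          gcongr
      _ = gammaSeq μ d₀ F (i + 1) * d ^ (i + 1 + 1) := by
          rw [gammaSeq_succ]; ring

/-- **(18): `d(X⁽ᵏ⁺¹⁾) ≤ γ·d(X⁽ᵏ⁾)^{p+1}` with `γ = γ_p ≥ 0` independent of `k`** [cite: AlefeldHerzberger1983, Ch. 7 §D Thm 5 (18)] -/
theorem width_succ_le_pow (hr : IsTaylorNewtonRun f m₁ m₂ p flo fhi ξ lo hi x wlo whi) (k : ℕ) :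
    hi (k + 1) - lo (k + 1) ≤
      gammaSeq (min |m₁| |m₂|) (hi 0 - lo 0) (fun v => max |flo v| |fhi v|) p * (hi k - lo k) ^ (p + 1) := by
  have hsub : Icc (lo (k + 1)) (hi (k + 1)) ⊆ Icc (wlo k p) (whi k p) := by rw [hr.succ_eq k]
  obtain ⟨h1, h2⟩ := (Icc_subset_Icc_iff (hr.lo_le_hi (k + 1))).1 hsub
  linarith [hr.width_inner_le k (le_refl p)]

/-- **The R-order of `{X⁽ᵏ⁾}` is at least `p + 1`** — *"Therefore, according to Theorem 2,
Appendix A"* — for the width sequence `d(X⁽ᵏ⁾)` (`ROrderConvergence.ROrder`) [cite: AlefeldHerzberger1983, Ch. 7 §D Thm 5] [cite: AlefeldHerzberger1983, Appendix A Thm 2] -/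
theorem succ_le_ROrder_width (hr : IsTaylorNewtonRun f m₁ m₂ p flo fhi ξ lo hi x wlo whi) :
    ((p + 1 : ℕ) : EReal) ≤ ROrderConvergence.ROrder (fun k => hi k - lo k) :=
  ROrderConvergence.le_ROrder_of_le_mul_pow (n := p + 1) (by have := hr.one_le; omega)
    (fun k => sub_nonneg.2 (hr.lo_le_hi k)) hr.tendsto_width (k₀ := 0)
    (fun k _ => hr.width_succ_le_pow k)

/-- **(17), the alternative: the run "comes to a rest at the point `[ξ, ξ]`"** — if `f(x⁽ᵏ⁾) = 0`
(exact arithmetic) then `X⁽ᵏ⁺¹⁾ = [ξ, ξ]` (`{x⁽ᵏ⁾ − 0/M} = {x⁽ᵏ⁾}` and `ξ ∈ X⁽ᵏ⁺¹⁾ ⊆ X⁽ᵏ⁺¹'⁰⁾`)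
[cite: AlefeldHerzberger1983, Ch. 7 §D Thm 5 (17)] -/
theorem rest_of_eval_eq_zero (hr : IsTaylorNewtonRun f m₁ m₂ p flo fhi ξ lo hi x wlo whi) {k : ℕ}
    (hfx : f (x k) = 0) : Icc (lo (k + 1)) (hi (k + 1)) = Icc ξ ξ := by
  have hM : (Icc m₁ m₂).Nonempty := ⟨_, hr.deriv_mem ξ hr.root_mem_zero⟩
  have hsub : Icc (lo (k + 1)) (hi (k + 1)) ⊆ {x k} := by
    intro z hz
    have hz' := hr.succ_subset_inner_zero k hz
    rw [hr.inner_zero k, hfx, newtonSet_of_eq_zero hM] at hz'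
    exact hz'.2
  have hξ := hr.root_mem (k + 1)
  have hxξ : x k = ξ := (mem_singleton_iff.1 (hsub hξ)).symm
  refine Subset.antisymm (fun z hz => ?_) (fun z hz => ?_)
  · have := mem_singleton_iff.1 (hsub hz); rw [this, hxξ]; exact ⟨le_rfl, le_rfl⟩
  · rw [Set.Icc_self, mem_singleton_iff] at hz; rw [hz]; exact hξ

end IsTaylorNewtonRun

/-- **Theorem 5 (Alefeld–Herzberger, Ch. 7 §D) for general `p ≥ 1`, packaged.**  Along a run of (15)
with a zero `ξ ∈ X⁽⁰⁾`: (16) `ξ ∈ X⁽ᵏ⁾` and `ξ ∈ X⁽ᵏ⁺¹'ⁱ⁾` (`0 ≤ i ≤ p`) for all `k`; (17)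
`X⁽⁰⁾ ⊇ X⁽¹⁾ ⊇ ⋯`, `d(X⁽ᵏ⁺¹⁾) ≤ (1 − m₁/m₂) d(X⁽ᵏ⁾)`, `d(X⁽ᵏ⁾) ≤ (1 − m₁/m₂)ᵏ d(X⁽⁰⁾)`, `x₁⁽ᵏ⁾ → ξ`,
`x₂⁽ᵏ⁾ → ξ`, `⋂ₖ X⁽ᵏ⁾ = {ξ}`; (18) `d(X⁽ᵏ⁺¹⁾) ≤ γ_p d(X⁽ᵏ⁾)^{p+1}` with the book's `γ_p ≥ 0`; and the
R-order of the widths is at least `p + 1` (Appendix A, Thm 2)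
[cite: AlefeldHerzberger1983, Ch. 7 §D Thm 5] [cite: AlefeldHerzberger1983, Appendix A Thm 2] -/
theorem alefeldHerzberger_ch7_thm5 {f : ℝ → ℝ} {m₁ m₂ : ℝ} {p : ℕ} {flo fhi : ℕ → ℝ} {ξ : ℝ}
    {lo hi x : ℕ → ℝ} {wlo whi : ℕ → ℕ → ℝ}
    (hr : IsTaylorNewtonRun f m₁ m₂ p flo fhi ξ lo hi x wlo whi) :
    (∀ k, ξ ∈ Icc (lo k) (hi k) ∧ ∀ i, i ≤ p → ξ ∈ Icc (wlo k i) (whi k i)) ∧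
      (∀ k, Icc (lo (k + 1)) (hi (k + 1)) ⊆ Icc (lo k) (hi k)) ∧
      (∀ k, hi (k + 1) - lo (k + 1) ≤ newtonFactor m₁ m₂ * (hi k - lo k)) ∧
      (∀ k, hi k - lo k ≤ newtonFactor m₁ m₂ ^ k * (hi 0 - lo 0)) ∧
      Tendsto lo atTop (𝓝 ξ) ∧ Tendsto hi atTop (𝓝 ξ) ∧ (⋂ k, Icc (lo k) (hi k)) = {ξ} ∧
      (0 ≤ gammaSeq (min |m₁| |m₂|) (hi 0 - lo 0) (fun v => max |flo v| |fhi v|) p ∧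
        ∀ k, hi (k + 1) - lo (k + 1) ≤
          gammaSeq (min |m₁| |m₂|) (hi 0 - lo 0) (fun v => max |flo v| |fhi v|) p *
            (hi k - lo k) ^ (p + 1)) ∧
      ((p + 1 : ℕ) : EReal) ≤ ROrderConvergence.ROrder (fun k => hi k - lo k) := by
  refine ⟨fun k => ⟨hr.root_mem k, fun i hip => hr.root_mem_inner k hip⟩, hr.succ_subset,
    hr.width_succ_le, hr.width_le_pow, hr.tendsto_lo, hr.tendsto_hi, hr.iInter_eq, ⟨?_, hr.width_succ_le_pow⟩,
    hr.succ_le_ROrder_width⟩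
  have hd₀ : 0 ≤ hi 0 - lo 0 := sub_nonneg.2 (hr.lo_le_hi 0)
  exact gammaSeq_nonneg hr.modulus_pos hd₀ (fun v => (abs_nonneg _).trans (le_max_left _ _)) p

end Literature.Analysis.ValidatedNumerics.HigherOrderIntervalNewton
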